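import Summits.QuantumFields.YangMills.Theorems.UnitScaleTiltProp8FibreTangentAvg
import HarnessLib

/-!
# Route `UnitScaleTilt`, crux K1 «MinimiserStabilityRegPr» (stmt-QuantumFields-19200), stub `stub_prop8` (V2) — sub-lemma C_k qualitative, part U1:
# **THE ONE-STEP (0.4)-FIBRE IS A GRAPH OVER THE NON-CENTRAL BONDS** — injectivity of the guarded fibre map in the central coordinate
# (`norm_fibreCore_sub_sub_le`, `eq_of_fibreCore_eq`) and uniqueness of the central bonds given the average (`eq_of_avgFun_eq_of_agree`)

Cell `ym3-torus` ∕ fleet seat `ym-ust-19200-p2` g4.  The exact corrector (p448916 ∕ part 7a) gives EXISTENCE of a point of the one-step fibre `{Ū′ = V}` over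
prescribed non-central bonds; this file gives UNIQUENESS near a small field: the fibre map `K_h(W) = eml(1 | h_iW^*)·W` of the central coordinate satisfies
`‖K(W₂) − K(W₁) − (W₂ − W₁)‖ ≤ (θ + 147v)·‖W₂ − W₁‖` (`θ = #off-central∕|I| ≤ 1 − |I|⁻¹`, `v` = distance of the tuples from the identity) — mean value
inequality along the segment of tuples with part 4's `norm_fderiv_eml_sub_mean_le` (`D eml = mean + O(v)`) and the observation that the mean of an
OFF-CENTRAL tuple has norm `≤ θ·sup` — hence `K` is injective as soon as `147v < |I|⁻¹`; on the lattice: two `t`-small configurations with the same one-step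
average that agree off the central bonds and are `ρ`-close on them (`stokesConst·t + ρ` small) are EQUAL.  With parts 7c ∕ 7f (tangent curves, k-fold
corrector) this completes the qualitative chart «C_k» of the census at a fixed lattice for one step; the k-fold uniqueness is part U2.  Sorry-free, no
definition. [folklore] ∕ cited.  References: T. Bałaban, CMP 102 (1985) 277–309 [Balaban1985Variational] ((47)–(48) p.287); CMP 109 (1987) 249–301
[Balaban1987RG1] ((0.4) p.253).
-/

noncomputable section

open scoped BigOperators Matrix.Norms.L2Operator Matrix
open Filter Topology Asymptotics NormedSpace Function Set

namespace Summit.QuantumFields.YangMills.Theorems.Prop8Criticality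

open Literature.MathematicalPhysics.QuantumFieldTheory.Balaban1983to89
open T4Continuum

variable {P : Params} {j : ℕ}

/-! ## §1 The fibre map in the central coordinate is injective near a small field -/

section FibreCore

open ExpMeanLog B7TransferAnalyticMean BlockAveragingEMLAnalyticMean

variable {ι : Type*} [Fintype ι] (cen : ι → Prop) [DecidablePred cen]

/-- The arithmetic mean of an OFF-CENTRAL tuple `(0 | h_iX^*)` with unitary `h_i` has norm at most `θ·‖X‖`, `θ = #{off-central}∕|I|`. [folklore] -/
theorem norm_meanCLM_tupleDir_le (h : ι → Matrix (Fin 2) (Fin 2) ℂ) (hh : ∀ i, ¬ cen i → h i ∈ Matrix.unitaryGroup (Fin 2) ℂ) (X : Matrix (Fin 2) (Fin 2) ℂ) :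
    ‖meanCLM ι (Matrix (Fin 2) (Fin 2) ℂ) (fun i => if cen i then (0 : Matrix (Fin 2) (Fin 2) ℂ) else h i * star X)‖ ≤
      (((Finset.univ.filter fun i => ¬ cen i).card : ℝ)) / (Fintype.card ι : ℝ) * ‖X‖ := by
  rw [meanCLM_apply, norm_smul, norm_inv, Complex.norm_natCast]
  have hsum : ∑ i, (if cen i then (0 : Matrix (Fin 2) (Fin 2) ℂ) else h i * star X) =
      ∑ i ∈ Finset.univ.filter (fun i => ¬ cen i), h i * star X := by
    rw [Finset.sum_filter]
    refine Finset.sum_congr rfl fun i _ => ?_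
    by_cases hc : cen i <;> simp [hc]
  rw [hsum]
  have hterm : ∀ i ∈ Finset.univ.filter (fun i => ¬ cen i), ‖h i * star X‖ ≤ ‖X‖ := by
    intro i hi
    have hc : ¬ cen i := (Finset.mem_filter.mp hi).2
    calc ‖h i * star X‖ ≤ ‖h i‖ * ‖star X‖ := norm_mul_le _ _
      _ = ‖X‖ := by rw [UnitaryModel.norm_of_mem_unitaryGroup (hh i hc), one_mul, norm_star]
  have hs := (norm_sum_le _ _).trans (Finset.sum_le_sum hterm)
  rw [Finset.sum_const, nsmul_eq_mul] at hs
  rcases (Nat.cast_nonneg (Fintype.card ι) : (0 : ℝ) ≤ Fintype.card ι).eq_or_lt with h0 | hpos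
  · rw [← h0]; simp
  · calc (Fintype.card ι : ℝ)⁻¹ * ‖∑ i ∈ Finset.univ.filter (fun i => ¬ cen i), h i * star X‖
        ≤ (Fintype.card ι : ℝ)⁻¹ * (((Finset.univ.filter fun i => ¬ cen i).card : ℝ) * ‖X‖) :=
          mul_le_mul_of_nonneg_left hs (inv_nonneg.mpr hpos.le)
      _ = _ := by rw [div_eq_mul_inv]; ring

/-- **THE FIBRE MAP IS THE IDENTITY UP TO A CONTRACTION**: for `K_h(W) = eml(1 | h_iW^*)·W` with unitary off-central `h_i`, if the tuples of `W₁` and `W₂` are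
within `v ≤ 1/24` of the identity and `‖W₂‖ ≤ 1`, then `‖K(W₂) − K(W₁) − (W₂ − W₁)‖ ≤ (θ + 147v)·‖W₂ − W₁‖`. [cite: Balaban1987RG1, (0.4) p.253] -/
theorem norm_fibreCore_sub_sub_le (h : ι → Matrix (Fin 2) (Fin 2) ℂ) (hh : ∀ i, ¬ cen i → h i ∈ Matrix.unitaryGroup (Fin 2) ℂ)
    {W₁ W₂ : Matrix (Fin 2) (Fin 2) ℂ} (hW₂ : ‖W₂‖ ≤ 1) {v : ℝ}
    (hv₁ : ‖(fun i => if cen i then (1 : Matrix (Fin 2) (Fin 2) ℂ) else h i * star W₁) - 1‖ ≤ v)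
    (hv₂ : ‖(fun i => if cen i then (1 : Matrix (Fin 2) (Fin 2) ℂ) else h i * star W₂) - 1‖ ≤ v) (hv24 : v ≤ 1 / 24) :
    ‖(eml (fun i => if cen i then (1 : Matrix (Fin 2) (Fin 2) ℂ) else h i * star W₂) * W₂ -
        eml (fun i => if cen i then (1 : Matrix (Fin 2) (Fin 2) ℂ) else h i * star W₁) * W₁) - (W₂ - W₁)‖ ≤
      ((((Finset.univ.filter fun i => ¬ cen i).card : ℝ)) / (Fintype.card ι : ℝ) + 147 * v) * ‖W₂ - W₁‖ := by
  set T₁ : ι → Matrix (Fin 2) (Fin 2) ℂ := fun i => if cen i then (1 : Matrix (Fin 2) (Fin 2) ℂ) else h i * star W₁ with hT₁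
  set T₂ : ι → Matrix (Fin 2) (Fin 2) ℂ := fun i => if cen i then (1 : Matrix (Fin 2) (Fin 2) ℂ) else h i * star W₂ with hT₂
  set ΔT : ι → Matrix (Fin 2) (Fin 2) ℂ := fun i => if cen i then (0 : Matrix (Fin 2) (Fin 2) ℂ) else h i * star (W₂ - W₁) with hΔT
  set θ : ℝ := (((Finset.univ.filter fun i => ¬ cen i).card : ℝ)) / (Fintype.card ι : ℝ) with hθ
  have hθ0 : 0 ≤ θ := div_nonneg (Nat.cast_nonneg _) (Nat.cast_nonneg _)
  have hv0 : 0 ≤ v := (norm_nonneg _).trans hv₁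
  have hΔ : T₂ = T₁ + ΔT := by
    funext i
    simp only [hT₁, hT₂, hΔT, Pi.add_apply]
    split_ifs with hc
    · rw [add_zero]
    · rw [star_sub, mul_sub]; abel
  have hΔTle : ‖ΔT‖ ≤ ‖W₂ - W₁‖ := norm_tupleDir_le cen h hh (W₂ - W₁)
  -- the segment of tuples stays within `v` of the identity
  set Ts : ℝ → ι → Matrix (Fin 2) (Fin 2) ℂ := fun s => T₁ + (s : ℂ) • ΔT with hTs
  have hTsv : ∀ s : ℝ, 0 ≤ s → s ≤ 1 → ‖Ts s - 1‖ ≤ v := by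
    intro s hs0 hs1
    have hconv : Ts s - 1 = ((1 - s : ℝ) : ℂ) • (T₁ - 1) + (s : ℂ) • (T₂ - 1) := by
      rw [hTs, hΔ]; simp only []; push_cast
      module
    rw [hconv]
    calc ‖((1 - s : ℝ) : ℂ) • (T₁ - 1) + (s : ℂ) • (T₂ - 1)‖ ≤ ‖((1 - s : ℝ) : ℂ) • (T₁ - 1)‖ + ‖(s : ℂ) • (T₂ - 1)‖ := norm_add_le _ _
      _ = (1 - s) * ‖T₁ - 1‖ + s * ‖T₂ - 1‖ := by
          rw [norm_smul, norm_smul, Complex.norm_real, Complex.norm_real, Real.norm_eq_abs, Real.norm_eq_abs,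
            abs_of_nonneg (by linarith), abs_of_nonneg hs0]
      _ ≤ (1 - s) * v + s * v := add_le_add (mul_le_mul_of_nonneg_left hv₁ (by linarith)) (mul_le_mul_of_nonneg_left hv₂ hs0)
      _ = v := by ring
  have hTs1 : ∀ s : ℝ, 0 ≤ s → s ≤ 1 → ∀ i, ‖Ts s i - 1‖ < 1 := by
    intro s hs0 hs1 i
    have := (norm_le_pi_norm (Ts s - 1) i).trans (hTsv s hs0 hs1)
    rw [Pi.sub_apply, Pi.one_apply] at this
    linarith
  -- the derivative of `s ↦ eml(T_s)` and its bound
  have hderiv : ∀ s : ℝ, 0 ≤ s → s ≤ 1 →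
      HasDerivAt (fun s : ℝ => eml (Ts s)) (fderiv ℂ (eml : (ι → Matrix (Fin 2) (Fin 2) ℂ) → Matrix (Fin 2) (Fin 2) ℂ) (Ts s) ΔT) s := by
    intro s hs0 hs1
    have heml : HasFDerivAt (eml : (ι → Matrix (Fin 2) (Fin 2) ℂ) → Matrix (Fin 2) (Fin 2) ℂ)
        (fderiv ℂ (eml : (ι → Matrix (Fin 2) (Fin 2) ℂ) → Matrix (Fin 2) (Fin 2) ℂ) (Ts s)) (Ts s) :=
      (analyticAt_eml (hTs1 s hs0 hs1)).differentiableAt.hasFDerivAt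
    have hline : HasDerivAt (fun s : ℝ => T₁ + (s : ℂ) • ΔT) ΔT s := by
      have h1 : HasDerivAt (fun s : ℝ => (s : ℂ) • ΔT) ΔT s := by
        have := (hasDerivAt_id s).ofReal_comp.smul_const ΔT
        simpa using this
      simpa using h1.const_add T₁
    have h0 : Ts s = T₁ + (s : ℂ) • ΔT := rfl
    have := (heml.restrictScalars ℝ).comp_hasDerivAt_of_eq s hline h0
    simpa [Function.comp_def, hTs] using this
  have hbound : ∀ s : ℝ, 0 ≤ s → s ≤ 1 →
      ‖fderiv ℂ (eml : (ι → Matrix (Fin 2) (Fin 2) ℂ) → Matrix (Fin 2) (Fin 2) ℂ) (Ts s) ΔT‖ ≤ (θ + 144 * v) * ‖W₂ - W₁‖ := by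
    intro s hs0 hs1
    have h1 := norm_fderiv_eml_sub_mean_le (U := Ts s) ((hTsv s hs0 hs1).trans hv24) ΔT
    have h2 : ‖meanCLM ι (Matrix (Fin 2) (Fin 2) ℂ) ΔT‖ ≤ θ * ‖W₂ - W₁‖ := norm_meanCLM_tupleDir_le cen h hh (W₂ - W₁)
    have h3 : ‖fderiv ℂ (eml : (ι → Matrix (Fin 2) (Fin 2) ℂ) → Matrix (Fin 2) (Fin 2) ℂ) (Ts s) ΔT‖ ≤
        ‖fderiv ℂ (eml : (ι → Matrix (Fin 2) (Fin 2) ℂ) → Matrix (Fin 2) (Fin 2) ℂ) (Ts s) ΔT - meanCLM ι (Matrix (Fin 2) (Fin 2) ℂ) ΔT‖ +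
          ‖meanCLM ι (Matrix (Fin 2) (Fin 2) ℂ) ΔT‖ := by
      have := norm_add_le (fderiv ℂ (eml : (ι → Matrix (Fin 2) (Fin 2) ℂ) → Matrix (Fin 2) (Fin 2) ℂ) (Ts s) ΔT - meanCLM ι (Matrix (Fin 2) (Fin 2) ℂ) ΔT)
        (meanCLM ι (Matrix (Fin 2) (Fin 2) ℂ) ΔT)
      rwa [sub_add_cancel] at this
    have h4 : 144 * ‖ΔT‖ * ‖Ts s - 1‖ ≤ 144 * v * ‖W₂ - W₁‖ := by
      have := hTsv s hs0 hs1
      calc 144 * ‖ΔT‖ * ‖Ts s - 1‖ ≤ 144 * ‖W₂ - W₁‖ * v := by gcongr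
        _ = 144 * v * ‖W₂ - W₁‖ := by ring
    nlinarith [h1, h2, h3, h4]
  -- mean value inequality along the segment
  have hmvt : ‖eml T₂ - eml T₁‖ ≤ (θ + 144 * v) * ‖W₂ - W₁‖ := by
    have hT1' : Ts 1 = T₂ := by simp [hTs, hΔ]
    have hT0' : Ts 0 = T₁ := by simp [hTs]
    have := norm_image_sub_le_of_norm_deriv_le_segment_01' (f := fun s : ℝ => eml (Ts s))
      (f' := fun s => fderiv ℂ (eml : (ι → Matrix (Fin 2) (Fin 2) ℂ) → Matrix (Fin 2) (Fin 2) ℂ) (Ts s) ΔT)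
      (fun s hs => (hderiv s hs.1 hs.2).hasDerivWithinAt) (fun s hs => hbound s hs.1 hs.2.le)
    simpa only [hT1', hT0'] using this
  -- `eml(T₁) = 1 + O(v)`
  have p3 : ‖eml T₁ - 1‖ ≤ (5 / 2) * v := by
    have hV : ‖T₁ - 1‖ ≤ 1 / 12 := hv₁.trans (hv24.trans (by norm_num))
    have h1 := norm_eml_one_add_sub_sub_mean_le (V := T₁ - 1) hV
    rw [add_sub_cancel] at h1
    have h2 := norm_meanCLM_apply_le (ι := ι) (𝔄 := Matrix (Fin 2) (Fin 2) ℂ) (T₁ - 1)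
    have h3 : ‖eml T₁ - 1‖ ≤ ‖eml T₁ - 1 - meanCLM ι (Matrix (Fin 2) (Fin 2) ℂ) (T₁ - 1)‖ + ‖meanCLM ι (Matrix (Fin 2) (Fin 2) ℂ) (T₁ - 1)‖ := by
      have := norm_add_le (eml T₁ - 1 - meanCLM ι (Matrix (Fin 2) (Fin 2) ℂ) (T₁ - 1)) (meanCLM ι (Matrix (Fin 2) (Fin 2) ℂ) (T₁ - 1))
      rwa [sub_add_cancel] at this
    have h4 : ‖T₁ - 1‖ ^ 2 ≤ v * (1 / 24) := by
      rw [sq]; exact mul_le_mul hv₁ (hv₁.trans hv24) (norm_nonneg _) hv0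
    nlinarith [h1, h2, h3, h4, hv₁, norm_nonneg (T₁ - 1)]
  -- assemble
  have hid : eml T₂ * W₂ - eml T₁ * W₁ - (W₂ - W₁) = (eml T₂ - eml T₁) * W₂ + (eml T₁ - 1) * (W₂ - W₁) := by noncomm_ring
  rw [hid]
  have hΔW0 := norm_nonneg (W₂ - W₁)
  calc ‖(eml T₂ - eml T₁) * W₂ + (eml T₁ - 1) * (W₂ - W₁)‖
      ≤ ‖eml T₂ - eml T₁‖ * ‖W₂‖ + ‖eml T₁ - 1‖ * ‖W₂ - W₁‖ :=
        (norm_add_le _ _).trans (add_le_add (norm_mul_le _ _) (norm_mul_le _ _))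
    _ ≤ (θ + 144 * v) * ‖W₂ - W₁‖ * 1 + (5 / 2) * v * ‖W₂ - W₁‖ := by
        gcongr
    _ ≤ (θ + 147 * v) * ‖W₂ - W₁‖ := by nlinarith

/-- **INJECTIVITY OF THE FIBRE MAP IN THE CENTRAL COORDINATE**: under the hypotheses of `norm_fibreCore_sub_sub_le` with `‖W₁‖ ≤ 1` too, if
`θ ≤ 1 − κ` and `147v < κ`, then `K(W₁) = K(W₂)` forces `W₁ = W₂`. [cite: Balaban1987RG1, (0.4) p.253] -/
theorem eq_of_fibreCore_eq (h : ι → Matrix (Fin 2) (Fin 2) ℂ) (hh : ∀ i, ¬ cen i → h i ∈ Matrix.unitaryGroup (Fin 2) ℂ)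
    {W₁ W₂ : Matrix (Fin 2) (Fin 2) ℂ} (hW₂ : ‖W₂‖ ≤ 1) {v κ : ℝ}
    (hv₁ : ‖(fun i => if cen i then (1 : Matrix (Fin 2) (Fin 2) ℂ) else h i * star W₁) - 1‖ ≤ v)
    (hv₂ : ‖(fun i => if cen i then (1 : Matrix (Fin 2) (Fin 2) ℂ) else h i * star W₂) - 1‖ ≤ v) (hv24 : v ≤ 1 / 24)
    (hθ : (((Finset.univ.filter fun i => ¬ cen i).card : ℝ)) / (Fintype.card ι : ℝ) ≤ 1 - κ) (hκ : 147 * v < κ)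
    (heq : eml (fun i => if cen i then (1 : Matrix (Fin 2) (Fin 2) ℂ) else h i * star W₂) * W₂ =
      eml (fun i => if cen i then (1 : Matrix (Fin 2) (Fin 2) ℂ) else h i * star W₁) * W₁) :
    W₁ = W₂ := by
  have hest := norm_fibreCore_sub_sub_le cen h hh hW₂ hv₁ hv₂ hv24
  rw [heq, sub_self, zero_sub, norm_neg] at hest
  have hlt : (((Finset.univ.filter fun i => ¬ cen i).card : ℝ)) / (Fintype.card ι : ℝ) + 147 * v < 1 := by linarith
  by_contra hne
  have hpos : 0 < ‖W₂ - W₁‖ := norm_pos_iff.mpr (sub_ne_zero.mpr (Ne.symm hne))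
  nlinarith

end FibreCore

/-! ## §2 On the lattice: the central bonds are determined by the average and the non-central bonds -/

section Lattice

open AveragingRT BlockAveraging BlockAveragingHaarAC BlockAveragingEMLHaarAC ExpMeanLog
open Summit.QuantumFields.YangMills.Theorems.BlockAvgCorrector (stokesConst stokesConst_nonneg emlWeight_pos emlWeight_le_one
  norm_openHol_mul_star_sub_one_le plaqSmall_of_forall_norm_sub_le)

/-- **UNIQUENESS OF THE CENTRAL BONDS ON A ONE-STEP (0.4)-FIBRE**: let `U` be `t`-small and let `U′` agree with `U` at every non-central bond, be within `ρ` of `U`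
at every central bond, with `stokesConst·(t + 4ρ) + ρ ≤ min(1/24, |I|⁻¹/148)`.  If `Ū′ = Ū` then `U′ = U` — near a small field the one-step fibre is a GRAPH over
the non-central bonds (existence of the graph: the exact corrector p448916; this is its uniqueness). [cite: Balaban1987RG1, (0.4) p.253; Balaban1985Variational, (47) p.287] -/
theorem eq_of_avgFun_eq_of_agree [DecidableEq (PBond P j)] (hj : j + 1 ≤ P.m + P.K) {t ρ : ℝ} (ht : 0 ≤ t) (hρ : 0 ≤ ρ)
    (h24 : stokesConst P * (t + 4 * ρ) + ρ ≤ 1 / 24) (hκ : 148 * (stokesConst P * (t + 4 * ρ) + ρ) ≤ emlWeight P)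
    (U U' : GaugeField P j (Matrix.specialUnitaryGroup (Fin 2) ℂ)) (hU : PlaqSmall t U)
    (hagree : ∀ b : PBond P j, (∀ c : PBond P (j + 1), centralBond c ≠ b) → U' b = U b)
    (hclose : ∀ c : PBond P (j + 1), ‖((U' (centralBond c) : Matrix.specialUnitaryGroup (Fin 2) ℂ) : Matrix (Fin 2) (Fin 2) ℂ) -
      (U (centralBond c) : Matrix (Fin 2) (Fin 2) ℂ)‖ ≤ ρ)
    (havg : avgFun (expMeanLogSU (n := Fin 2)) U' = avgFun (expMeanLogSU (n := Fin 2)) U) : U' = U := by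
  have hκpos := emlWeight_pos P
  have hst := stokesConst_nonneg P
  have hδ : (expMeanLogSU (n := Fin 2)).δ = 1 / 3 := expMeanLogSU_two_δ
  -- every central bond agrees
  have hcentral : ∀ c : PBond P (j + 1), U' (centralBond c) = U (centralBond c) := by
    intro c
    set g : Matrix.specialUnitaryGroup (Fin 2) ℂ := U' (centralBond c) with hg
    -- the two central coordinates
    obtain ⟨W, hWdef⟩ : ∃ W : Matrix (Fin 2) (Fin 2) ℂ, W = ((pre U c : Matrix.specialUnitaryGroup (Fin 2) ℂ) : Matrix (Fin 2) (Fin 2) ℂ) *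
      (U (centralBond c) : Matrix (Fin 2) (Fin 2) ℂ) * ((post U c : Matrix.specialUnitaryGroup (Fin 2) ℂ) : Matrix (Fin 2) (Fin 2) ℂ) := ⟨_, rfl⟩
    obtain ⟨W', hW'def⟩ : ∃ W' : Matrix (Fin 2) (Fin 2) ℂ, W' = ((pre U c : Matrix.specialUnitaryGroup (Fin 2) ℂ) : Matrix (Fin 2) (Fin 2) ℂ) *
      (g : Matrix (Fin 2) (Fin 2) ℂ) * ((post U c : Matrix.specialUnitaryGroup (Fin 2) ℂ) : Matrix (Fin 2) (Fin 2) ℂ) := ⟨_, rfl⟩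
    -- the updated configuration is small at `c`
    have hupd : ∀ b, ‖((update U (centralBond c) g b : Matrix.specialUnitaryGroup (Fin 2) ℂ) : Matrix (Fin 2) (Fin 2) ℂ) - (U b : Matrix (Fin 2) (Fin 2) ℂ)‖ ≤ ρ := by
      intro b
      by_cases hb : b = centralBond c
      · subst hb; rw [update_self]; exact hclose c
      · rw [update_of_ne hb, sub_self, norm_zero]; exact hρ
    have hplaqu : PlaqSmall (t + 4 * ρ) (update U (centralBond c) g) := plaqSmall_of_forall_norm_sub_le hU hupd
    have hsmu : Small (expMeanLogSU (n := Fin 2)) (update U (centralBond c) g) c := by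
      intro i
      have h1 := LatticeWordStokes.dist1_loopHol_le (by positivity : (0 : ℝ) ≤ t + 4 * ρ) hplaqu c i
      rw [hδ]; refine h1.trans_lt ?_
      show stokesConst P * (t + 4 * ρ) < 1 / 3
      linarith
    have hsm0 : Small (expMeanLogSU (n := Fin 2)) (update U (centralBond c) (U (centralBond c))) c := by
      rw [update_eq_self]
      intro i
      have h1 := LatticeWordStokes.dist1_loopHol_le ht hU c i
      rw [hδ]; refine h1.trans_lt ?_
      show stokesConst P * t < 1 / 3
      nlinarith
    -- both averages at `c` in the normal form of the central coordinate
    have h1 : avgFun (expMeanLogSU (n := Fin 2)) U' c = avgFun (expMeanLogSU (n := Fin 2)) (update U (centralBond c) g) c :=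
      avgFun_eq_avgFun_update_of_agree hj _ U U' c hagree
    have h2 : avgFun (expMeanLogSU (n := Fin 2)) U c = avgFun (expMeanLogSU (n := Fin 2)) (update U (centralBond c) (U (centralBond c))) c := by
      rw [update_eq_self]
    have hK' := coe_avgFun_update_centralBond hj U c g hsmu
    have hK := coe_avgFun_update_centralBond hj U c (U (centralBond c)) hsm0
    have heq : ((avgFun (expMeanLogSU (n := Fin 2)) U' c : Matrix.specialUnitaryGroup (Fin 2) ℂ) : Matrix (Fin 2) (Fin 2) ℂ) =
        ((avgFun (expMeanLogSU (n := Fin 2)) U c : Matrix.specialUnitaryGroup (Fin 2) ℂ) : Matrix (Fin 2) (Fin 2) ℂ) := by rw [havg]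
    rw [h1, h2, hK', hK] at heq
    rw [← hWdef, ← hW'def] at heq
    have hWax : W = ((axialAvg U c : Matrix.specialUnitaryGroup (Fin 2) ℂ) : Matrix (Fin 2) (Fin 2) ℂ) := by
      rw [hWdef, axialAvg_eq_pre_mul_mul_post, Submonoid.coe_mul, Submonoid.coe_mul]
    have hW'u : W' ∈ Matrix.unitaryGroup (Fin 2) ℂ := by
      rw [hW'def]; exact (pre U c * g * post U c).2.1
    have hW'1 : ‖W'‖ ≤ 1 := (UnitaryModel.norm_of_mem_unitaryGroup hW'u).le
    have hWW' : ‖W' - W‖ ≤ ρ := by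
      rw [hWdef, hW'def, ← sub_mul, ← mul_sub]
      calc _ ≤ ‖((pre U c : Matrix.specialUnitaryGroup (Fin 2) ℂ) : Matrix (Fin 2) (Fin 2) ℂ) * ((g : Matrix (Fin 2) (Fin 2) ℂ) - (U (centralBond c) : Matrix (Fin 2) (Fin 2) ℂ))‖ *
            ‖((post U c : Matrix.specialUnitaryGroup (Fin 2) ℂ) : Matrix (Fin 2) (Fin 2) ℂ)‖ := norm_mul_le _ _
        _ ≤ ‖(g : Matrix (Fin 2) (Fin 2) ℂ) - (U (centralBond c) : Matrix (Fin 2) (Fin 2) ℂ)‖ * 1 := by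
            rw [norm_coe_su2]
            gcongr
            exact (norm_mul_le _ _).trans (by rw [norm_coe_su2, one_mul])
        _ ≤ ρ := by rw [mul_one]; exact hclose c
    have hhu : ∀ i, ¬ IsCentral c i →
        ((openHol U c i : Matrix.specialUnitaryGroup (Fin 2) ℂ) : Matrix (Fin 2) (Fin 2) ℂ) ∈ Matrix.unitaryGroup (Fin 2) ℂ :=
      fun i _ => (openHol U c i).2.1
    -- tuple bounds
    have hTi : ∀ i, ‖(if IsCentral c i then (1 : Matrix (Fin 2) (Fin 2) ℂ) else
        ((openHol U c i : Matrix.specialUnitaryGroup (Fin 2) ℂ) : Matrix (Fin 2) (Fin 2) ℂ) * star W) - 1‖ ≤ stokesConst P * t := by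
      intro i
      split_ifs with hc
      · rw [sub_self, norm_zero]; positivity
      · rw [hWax]; exact norm_openHol_mul_star_sub_one_le ht hU c i
    have hTi' : ∀ i, ‖(if IsCentral c i then (1 : Matrix (Fin 2) (Fin 2) ℂ) else
        ((openHol U c i : Matrix.specialUnitaryGroup (Fin 2) ℂ) : Matrix (Fin 2) (Fin 2) ℂ) * star W') - 1‖ ≤ stokesConst P * t + ρ := by
      intro i
      split_ifs with hc
      · rw [sub_self, norm_zero]; positivity
      · have e1 : ((openHol U c i : Matrix.specialUnitaryGroup (Fin 2) ℂ) : Matrix (Fin 2) (Fin 2) ℂ) * star W' - 1 =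
            (((openHol U c i : Matrix.specialUnitaryGroup (Fin 2) ℂ) : Matrix (Fin 2) (Fin 2) ℂ) * star W - 1) +
              ((openHol U c i : Matrix.specialUnitaryGroup (Fin 2) ℂ) : Matrix (Fin 2) (Fin 2) ℂ) * star (W' - W) := by
          rw [star_sub]; noncomm_ring
        rw [e1]
        refine (norm_add_le _ _).trans (add_le_add ?_ ?_)
        · rw [hWax]; exact norm_openHol_mul_star_sub_one_le ht hU c i
        · calc _ ≤ ‖((openHol U c i : Matrix.specialUnitaryGroup (Fin 2) ℂ) : Matrix (Fin 2) (Fin 2) ℂ)‖ * ‖star (W' - W)‖ := norm_mul_le _ _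
            _ ≤ ρ := by rw [norm_coe_su2, one_mul, norm_star]; exact hWW'
    have hv₁ : ‖(fun i => if IsCentral c i then (1 : Matrix (Fin 2) (Fin 2) ℂ) else
        ((openHol U c i : Matrix.specialUnitaryGroup (Fin 2) ℂ) : Matrix (Fin 2) (Fin 2) ℂ) * star W) - 1‖ ≤ stokesConst P * (t + 4 * ρ) + ρ := by
      refine (pi_norm_le_iff_of_nonneg (by positivity)).mpr fun i => ?_
      rw [Pi.sub_apply, Pi.one_apply]
      exact (hTi i).trans (by nlinarith)
    have hv₂ : ‖(fun i => if IsCentral c i then (1 : Matrix (Fin 2) (Fin 2) ℂ) else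
        ((openHol U c i : Matrix.specialUnitaryGroup (Fin 2) ℂ) : Matrix (Fin 2) (Fin 2) ℂ) * star W') - 1‖ ≤ stokesConst P * (t + 4 * ρ) + ρ := by
      refine (pi_norm_le_iff_of_nonneg (by positivity)).mpr fun i => ?_
      rw [Pi.sub_apply, Pi.one_apply]
      exact (hTi' i).trans (by nlinarith)
    have hθ := offCentral_ratio_le c
    have hWW : W = W' := by
      refine eq_of_fibreCore_eq (IsCentral c) (fun i => ((openHol U c i : Matrix.specialUnitaryGroup (Fin 2) ℂ) : Matrix (Fin 2) (Fin 2) ℂ))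
        hhu hW'1 hv₁ hv₂ h24 hθ (by linarith) ?_
      exact heq
    -- cancel the transports
    have hcoe : (g : Matrix (Fin 2) (Fin 2) ℂ) = (U (centralBond c) : Matrix (Fin 2) (Fin 2) ℂ) := by
      have e := congrArg (fun M => star ((pre U c : Matrix.specialUnitaryGroup (Fin 2) ℂ) : Matrix (Fin 2) (Fin 2) ℂ) * M *
        star ((post U c : Matrix.specialUnitaryGroup (Fin 2) ℂ) : Matrix (Fin 2) (Fin 2) ℂ)) hWW
      rw [hWdef, hW'def, star_coe_mul_mul_mul_star, star_coe_mul_mul_mul_star] at e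
      exact e.symm
    exact Subtype.ext hcoe
  funext b
  by_cases hb : ∃ c, centralBond c = b
  · obtain ⟨c, rfl⟩ := hb; exact hcentral c
  · push Not at hb
    exact hagree b fun c hc => hb c hc

end Lattice

end Summit.QuantumFields.YangMills.Theorems.Prop8Criticality

end
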